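import Summits.QuantumFields.YangMills.Theorems.BalabanUVNodesClustersCore
import Literature.MathematicalPhysics.QuantumFieldTheory.Balaban1983to89.B14NodeKnitRecord9
import Literature.MathematicalPhysics.QuantumFieldTheory.Balaban1983to89.Node00.Record11

/-!
# DAG node N11 — [B14] `Dag.B14_main` ([Balaban1988Convergent] CMP **119** (1988) 243–285: Theorem 1 p. 262, with the Theorem of p. 245 and the
# operation 𝐑 ASSUMED on p. 244 lines 36–38) AT NODE 00's STAGE-11 RECORD `Node00.IsRecordOfRecord₁₁C` (`Node00/Record11.lean`, p444286): the route's
# stub `YMDAG.UVSplit.S_N11 Rec := AtRecord Rec Dag.B14_main` at `Rec := IsRecordOfRecord₁₁C · N`, with the (𝐑) slot DISCHARGED BY THE PIN and the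
# §2-form reading `Iff.rfl` — N11 at a Stage-11 world = (S0) + (S1ᵀ) at the objects of record

Cell `pub-ymgap`, YM-PLAN Track A (HUMAN RULING D-0062), seat `pub-ymgap-dag-n11-c` (R134 fan-out seat, strategy s1; dag-lead FAN-OUT v1.1 §N11 s1
«₁₁ CONSUMER BY NAME» = REACTIVATE trigger t1 of the n11-a lineage; chair R420 ∕ R422 ∕ R424 ∕ R437 ∕ R447 ∕ R449; T-day rev-1 restate of
`route-QuantumFields-BalabanUVNodes` at ₁₁C, 2026-08-26).  [III] = Balaban1988Convergent, [II′] = Balaban1989LargeFieldII.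

WHY THIS FILE.  Through Stage 10 the (𝐑) slot of N11's knit — [III] p. 244's ASSUMED property of 𝐑 («𝐑′𝐓ρ_k, for 𝐓ρ_k in the corresponding space, has the
form (2.18) with the §2 conditions») — and the core's §2-form clause were read through RESIDUAL format predicates.  NODE 00's Stage 11 (`Record11`, seat
node00-def-T, tranche 11d) PINS both: the §2 [III] form of record `S218OfRecord₁₁` (a.e. reading `HasSect2FormAE` at the post-𝐑 slot family `slotsOfRecord`
of the represented tower and def-R's background maps), read at the density of record as `SLaw₁₁ θ P k`, and the «corresponding space» law `TLaw₁₁ θ P k` of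
the 𝐓-image `𝐓ρ_k`; the core's clause IS `SLaw₁₁` (`sect2Form_coreOfRecord₁₁_iff`, `Iff.rfl`) and the record's 𝐑-leaf at the pinned carriers `VOfRecord₁₁`
IS «`∀ k < K, TLaw₁₁ θ P k → SLaw₁₁ θ P (k+1)`» (`rOperation_upOfRecord₅C_stage11_iff`) — THEOREM 2 [III]'s statement shape at the objects of record, [II′]
Thm 1's content.  So at a Stage-11 world N11 needs no (𝐑) hypothesis and no reading hypothesis: `Dag.B14_main (leavesP w P)` follows from EXACTLY
(S0) «under the interval hypothesis the Wilson start `ρ₀` of record has the §2 form at index 0» (`smallCouplings → SLaw₁₁ θ P 0`) and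
(S1ᵀ) THE THEOREM OF [III] p. 245 AT THE OBJECTS OF RECORD «given N11's antecedents `b7 … b11`, the interval hypothesis, the small-field inductive
assumptions and the flow control (2.6): for `k < K`, if `ρ_k` of record has the §2 form then `𝐓ρ_k` of record lies in the corresponding space»
(`SLaw₁₁ θ P k → TLaw₁₁ θ P k`; [III] §1 for `k = 0`, §3 + Thm 2 for `k ≥ 1`) — the n11-a lineage's construction-generic
`B14NodeKnitRecord9.b14_main_at_construction_rhoOfRecord9_along` (slot recursion `slotsOfRecord_succ` = def-T's `rep (k+1) = Rstep k (Tstep k (rep k))`,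
`rfl`) with `LawsP := SLaw₁₁`, `LawsTP := TLaw₁₁`, `hS9 := Iff.rfl`, `hR :=` the pin.  The N11 half of seat dag-n13-a's Stage-10 junction
`B16NodeKnitRecord10.nodes_N11_N13_at_record₁₀`, re-keyed ₁₀ ↦ ₁₁ and carried to the route's currency `S_N11`.

WHAT THIS FILE PROVES (0 `sorry`, 0 `def`, standard axioms).  §1 POINTED, at Stage-11 parameters `θ` under their provisos `h` and a world `w` with `w.C =
(datumOfRecord₁₁ F N θ h).C`, `w.up P = upOfRecord₅C F N (θ.toStage5₁₁ F N) P`: `rOperation_iff_laws₁₁` (the leaf unfolded), `densitiesDescribed_iff_sLaw₁₁`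
(N11's CONCLUSION at `(w, P)` IS «every `ρ_k` of record, `k ≤ K`, has the §2 form»), **`b14_main_at_record₁₁`** (N11 from (S0) + (S1ᵀ)),
**`b14_main_iff_at_record₁₁`** (N11 UNFOLDED at ₁₁C — what the node SAYS there, both directions), `sLaw₁₁_all_of_b14_main` (A4 locator: N11 + its
antecedent leaves + law transport YIELD the §2 form of every density of record).  §2 KEYED on the record predicate: `leaf_b7_of_isRecordOfRecord₁₁C`,
`guards_of_isRecordOfRecord₁₁C` (in-edges `b4 b5 b7` HOLD at every run of every Stage-11 record — N01 ∕ N02 ∕ N04 are NODE 00 theorems at the ₅C shadow,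
transferred by `Record11` §8), **`b14_main_of_isRecordOfRecord₁₁C`** (per-(D, w): the slots (S0), (S1ᵀ) for every presenting `θ` ⇒ N11 at every run),
**`s_N11_of_refines₁₁C`** (every record predicate refining ₁₁C), **`s_N11_rec₁₁C`** (`S_N11` AT `IsRecordOfRecord₁₁C · N` ITSELF).  The n11-a tower-datum
form `BalabanUVNodesN11AtRecord.S_N11_of_towerSlots_along` is instantiated by the same terms (`M := coreOfRecord₁₁ θ`, `τ := towerOfRecord₁₁ θ h`,
`texpA := slotsOfRecord …`, `hρ := towerOfRecord₁₁_ρ`, `hS9` by `sLaw₁₁_iff`); the construction-generic route is used because it reads no tower obligation.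

HONEST FRAMING.  A count-neutral KNIT BY NAME (R429 (4)(i)); N11 is NOT discharged: (S1ᵀ) = [III] Sects. 1–3 + Thm 2 at the slots of record is a DISPLAYED
hypothesis (Bałaban's renormalization transformation estimates, proved nowhere in the tree for the objects of record); (S0) is displayed too (the Wilson
start's §2 form at index 0 — bookkeeping-close: zero terms, cf. `Record11.hasSect2FormAE_zeroTerms`; named first by seat dag-n13-e, not typed here); the
(𝐑) slot is NOT assumed — it is what the record's leaf SAYS ([II′] Thm 1's content, node N13's product); the in-edges `b8 b9 b10 b11` (N05 ∕ N06 ∕ N08 ∕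
N07), the small-field leaf (N09 ∧ N10) and the flow control stay antecedents AS PRINTED.  `IsRecordOfRecord₁₁C` is NOT known inhabited (K0 =
stmt-QuantumFields-19673); RIDER №7: `N`-generic (`[NeZero N]`), the route instantiates `F 2`.  One finite four-torus programme at fixed `ε`, Bałaban AS
PRINTED with locators; NOT ℝ⁴, NOT infinite volume, NOT OS, NOT a mass gap, NOT Clay.  Filed `--supports` K1 `StabilityBAtRecordR11e`
(stmt-QuantumFields-19674).  Sources: [III] Thm 1 p. 262, Theorem p. 245, p. 244, (2.18) p. 257, (2.23)–(2.42) pp. 258–261, Thm 2 p. 263, (3.24)–(3.25)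
p. 270; [II′] Thm 1 p. 355; [Balaban1989LargeFieldI] (0.2)–(0.4) p. 176.
-/

noncomputable section

open scoped BigOperators

namespace Summit.QuantumFields.YangMills.Theorems.BalabanUVNodesN11AtRecord11C

open Literature.MathematicalPhysics.QuantumFieldTheory.Balaban1983to89
open Literature.MathematicalPhysics.QuantumFieldTheory.Balaban1983to89.T4Continuum (T4Family FiniteEpsData)
open Literature.MathematicalPhysics.QuantumFieldTheory.Balaban1983to89.DagBinding (WorldP leavesP)
open Literature.MathematicalPhysics.QuantumFieldTheory.Balaban1983to89.Node00
open Literature.MathematicalPhysics.QuantumFieldTheory.Balaban1983to89.B14NodeKnitRecord9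
  (b14_main_at_construction_rhoOfRecord9_along densitiesDescribed_iff_laws_construction)
open YMDAG.UVSplit (Datum RecordPred AtRecord S_N11)

variable (F : T4Family) (N : ℕ) [NeZero N]

/-! ## §1. N11 at a Stage-11 world, POINTED at the presenting parameters -/

section Pointed

variable (θ : Stage11Params F N) (h : θ.Provisos₁₁) (w : WorldP) (P : B12.RunParams)

/-- **The record's 𝐑-leaf at the run `P`, UNFOLDED**: for a world bound to the C-binding of record over the Stage-11 view (`hup`), `(leavesP w P).rOperation`
IS «for every `k < K`: if `𝐓ρ_k` of record lies in the corresponding space (`TLaw₁₁`) then `ρ_{k+1} = 𝐑𝐓ρ_k` of record has the §2 form of record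
(`SLaw₁₁`)» — [Balaban1988Convergent] p. 244's assumed property of 𝐑 at the objects of record, [Balaban1989LargeFieldII] Thm 1's content
(`Node00.rOperation_upOfRecord₅C_stage11_iff`). [cite: Balaban1988Convergent, p.244 and Thm 2 p.263; Balaban1989LargeFieldII, Thm 1 p.355 (bookkeeping: the leaf unfolded)] -/
theorem rOperation_iff_laws₁₁ (hup : w.up P = upOfRecord₅C F N (θ.toStage5₁₁ F N) P) :
    (leavesP w P).rOperation ↔ ∀ k, k < P.K → TLaw₁₁ F N θ P k → SLaw₁₁ F N θ P (k + 1) := by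
  show (w.up P).rOperation ↔ _
  rw [hup]
  exact rOperation_upOfRecord₅C_stage11_iff F N θ P

/-- **N11's CONCLUSION at a Stage-11 world IS «every density of record `ρ_k`, `k ≤ K`, has the §2 [III] form of record»** (`SLaw₁₁ θ P k` =
`S218OfRecord₁₁` read at `densOfRecord₁₀`, i.e. `HasSect2FormAE` at the post-𝐑 slot family — `Node00.sLaw₁₁_iff`): the core's clause is the pin
(`sect2Form_coreOfRecord₁₁_iff`, `Iff.rfl`). [cite: Balaban1988Convergent, Thm 1 p.262, (2.18) p.257, (2.23)–(2.42) pp.258–261 (bookkeeping)] -/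
theorem densitiesDescribed_iff_sLaw₁₁ (hC : w.C = (datumOfRecord₁₁ F N θ h).C) :
    (leavesP w P).densitiesDescribed ↔ ∀ k, k ≤ P.K → SLaw₁₁ F N θ P k :=
  densitiesDescribed_iff_laws_construction F N (coreOfRecord₁₁ F N θ) w P θ.ν θ.τ9 (EOfRecord₁₀ F N θ.toStage9Params)
    (wOfRecord₉ F N θ.toStage9Params) θ.ppSel (gOfRecord₁₀ F N θ.toStage9Params) (fun p k _ => SLaw₁₁ F N θ p k)
    (hC.trans (datumOfRecord₁₁_C F N θ h)) (fun _ _ => Iff.rfl)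

/-- **N11 AT A STAGE-11 WORLD FROM (S0) + (S1ᵀ)** ([Balaban1988Convergent] Thm 1 p. 262 with the Theorem of p. 245; the 𝐑 of p. 244 DISCHARGED BY THE PIN):
at `w.C = (datumOfRecord₁₁ F N θ h).C`, `w.up P = upOfRecord₅C F N (θ.toStage5₁₁ F N) P`, `Dag.B14_main (leavesP w P)` follows from — (S0) `h0`: under the
interval hypothesis the Wilson start `ρ₀ = e^{−E}·exp(−A∕g₀²)` of record has the §2 form at index `0` (`SLaw₁₁ θ P 0`); (S1ᵀ) `hT`: THE THEOREM OF p. 245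
AT THE OBJECTS OF RECORD — GIVEN N11's in-edges `b7 … b11`, the interval hypothesis, the small-field inductive assumptions and the flow control (2.6): for
`k < K`, `SLaw₁₁ θ P k → TLaw₁₁ θ P k` ([III] §1 for `k = 0`, §3 + Thm 2 for `k ≥ 1`).  The (𝐑) antecedent `rOperation → (TLaw₁₁ k → SLaw₁₁ (k+1))` is
the pin (`rOperation_iff_laws₁₁`), the reading `Sect2Form ↔ SLaw₁₁` is `Iff.rfl`; n11-a's `B14NodeKnitRecord9.b14_main_at_construction_rhoOfRecord9_along`
BY NAME. [cite: Balaban1988Convergent, Thm 1 p.262; Theorem p.245; p.244; (2.18) p.257; (3.24)–(3.25) p.270] -/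
theorem b14_main_at_record₁₁ (hC : w.C = (datumOfRecord₁₁ F N θ h).C) (hup : w.up P = upOfRecord₅C F N (θ.toStage5₁₁ F N) P)
    (h0 : (leavesP w P).smallCouplings → SLaw₁₁ F N θ P 0)
    (hT : (leavesP w P).b7 → (leavesP w P).b8 → (leavesP w P).b9 → (leavesP w P).b10 → (leavesP w P).b11 →
      (leavesP w P).smallCouplings → (leavesP w P).smallFieldInductive → (leavesP w P).flowControl →
        ∀ k, k < P.K → SLaw₁₁ F N θ P k → TLaw₁₁ F N θ P k) :
    Dag.B14_main (leavesP w P) :=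
  b14_main_at_construction_rhoOfRecord9_along F N (coreOfRecord₁₁ F N θ) w P θ.ν θ.τ9 (EOfRecord₁₀ F N θ.toStage9Params)
    (wOfRecord₉ F N θ.toStage9Params) θ.ppSel (gOfRecord₁₀ F N θ.toStage9Params) (fun p k _ => SLaw₁₁ F N θ p k)
    (fun p k _ => TLaw₁₁ F N θ p k) (hC.trans (datumOfRecord₁₁_C F N θ h)) (fun _ _ => Iff.rfl) h0 hT
    (fun hrop => (rOperation_iff_laws₁₁ F N θ w P hup).1 hrop)

/-- **N11 UNFOLDED AT A STAGE-11 WORLD — what the node SAYS there, both directions**: `Dag.B14_main (leavesP w P)` IS «`b7 → b8 → b9 → b10 → b11 →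
(smallCouplings → smallFieldInductive) → (smallCouplings → flowControl) → (∀ k < K, TLaw₁₁ θ P k → SLaw₁₁ θ P (k+1)) → smallCouplings → ∀ k ≤ K,
SLaw₁₁ θ P k`» — the (𝐑) antecedent reads as law transport along the tower of record, the conclusion as the §2 form of every density of record.
[cite: Balaban1988Convergent, Thm 1 p.262, p.244, (2.18) p.257 (bookkeeping: the node unfolded at the objects of record)] -/
theorem b14_main_iff_at_record₁₁ (hC : w.C = (datumOfRecord₁₁ F N θ h).C) (hup : w.up P = upOfRecord₅C F N (θ.toStage5₁₁ F N) P) :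
    Dag.B14_main (leavesP w P) ↔
      ((leavesP w P).b7 → (leavesP w P).b8 → (leavesP w P).b9 → (leavesP w P).b10 → (leavesP w P).b11 →
        ((leavesP w P).smallCouplings → (leavesP w P).smallFieldInductive) →
        ((leavesP w P).smallCouplings → (leavesP w P).flowControl) →
        (∀ k, k < P.K → TLaw₁₁ F N θ P k → SLaw₁₁ F N θ P (k + 1)) →
        (leavesP w P).smallCouplings → ∀ k, k ≤ P.K → SLaw₁₁ F N θ P k) := by
  unfold Dag.B14_main
  rw [rOperation_iff_laws₁₁ F N θ w P hup, densitiesDescribed_iff_sLaw₁₁ F N θ h w P hC]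

/-- **What N11 SAYS at Stage 11** (A4 locator): N11 at a Stage-11-bound run, with its in-edge leaves `b7 … b11`, the small-field implication, the flow-control
implication, law transport along the tower of record (the 𝐑-leaf's content) and the interval hypothesis, YIELDS the §2 [III] form of record of EVERY density
`ρ_k`, `k ≤ K` — `S218OfRecord₁₁` at `densOfRecord₁₀`, i.e. localized terms `𝐄^{(i)}, 𝐑^{(i)}, 𝐁^{(i)}` obeying (2.27)–(2.28), (2.31), (2.41)–(2.42) on the
spaces of record with `ρ_k`'s slots `= 𝐓_k(s) exp A_k(s)` a.e. on the χ-support (what K1's (B) face reads through N24's glue).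
[cite: Balaban1988Convergent, Thm 1 p.262, (2.18) p.257, (2.23)–(2.42) pp.258–261 (bookkeeping)] -/
theorem sLaw₁₁_all_of_b14_main (hC : w.C = (datumOfRecord₁₁ F N θ h).C) (hup : w.up P = upOfRecord₅C F N (θ.toStage5₁₁ F N) P)
    (hN : Dag.B14_main (leavesP w P)) (h7 : (leavesP w P).b7) (h8 : (leavesP w P).b8) (h9 : (leavesP w P).b9) (h10 : (leavesP w P).b10)
    (h11 : (leavesP w P).b11) (hsf : (leavesP w P).smallCouplings → (leavesP w P).smallFieldInductive)
    (hfc : (leavesP w P).smallCouplings → (leavesP w P).flowControl) (hR : ∀ k, k < P.K → TLaw₁₁ F N θ P k → SLaw₁₁ F N θ P (k + 1))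
    (hsc : (leavesP w P).smallCouplings) : ∀ k, k ≤ P.K → SLaw₁₁ F N θ P k :=
  (b14_main_iff_at_record₁₁ F N θ h w P hC hup).1 hN h7 h8 h9 h10 h11 hsf hfc hR hsc

end Pointed

/-! ## §2. KEYED on the record predicate `IsRecordOfRecord₁₁C`; the route's stub `S_N11` -/

section Keyed

variable {F N}
variable {D : FiniteEpsData F (SU N)} {w : WorldP}

/-- **N04's leaf `b7` HOLDS OUTRIGHT at every run of every Stage-11 record** ([Balaban1985Averaging] Props. 1–10 at the objects of record: N01 `b4`, N02 `b4 → b5`,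
N04 `b5 → b7` are NODE 00 theorems at the ₅C shadow, transferred — `Node00.b4∕b5∕b7_main_of_isRecordOfRecord₁₁C`).
[cite: Balaban1985Averaging, Props. 1–10 pp.26–50 (kernel version at the objects of record, transferred; bookkeeping)] -/
theorem leaf_b7_of_isRecordOfRecord₁₁C (hrec : IsRecordOfRecord₁₁C F N D w) (P : B12.RunParams) : (leavesP w P).b7 :=
  b7_main_of_isRecordOfRecord₁₁C hrec P (b5_main_of_isRecordOfRecord₁₁C hrec P (b4_main_of_isRecordOfRecord₁₁C hrec P))

/-- **In-edge guards at every run of a Stage-11 record**: `b4`, `b5`, `b7` HOLD (so of N11's five in-edge leaves only `b8 b9 b10 b11` — N05 ∕ N06 ∕ N08 ∕ N07 —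
remain antecedents). [cite: Balaban1983RegularityDecay, Theorem p.573; Balaban1984PropagatorsI, Props. 1.1–1.2 pp.33–36; Balaban1985Averaging, Props. 1–10 pp.26–50 (kernel versions, transferred; bookkeeping)] -/
theorem guards_of_isRecordOfRecord₁₁C (hrec : IsRecordOfRecord₁₁C F N D w) (P : B12.RunParams) :
    (leavesP w P).b4 ∧ (leavesP w P).b5 ∧ (leavesP w P).b7 :=
  have h4 : (leavesP w P).b4 := b4_main_of_isRecordOfRecord₁₁C hrec P
  have h5 : (leavesP w P).b5 := b5_main_of_isRecordOfRecord₁₁C hrec P h4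
  ⟨h4, h5, b7_main_of_isRecordOfRecord₁₁C hrec P h5⟩

/-- **N11 AT EVERY RUN OF A STAGE-11 RECORD** from the per-parameter slots (S0), (S1ᵀ) at the objects of record: if for every admissible `θ` satisfying its
provisos and presenting `D` (with the world's binding clauses: construction, window `0 < w.γ ≤ θ.γ`, block size, C-binding) and every run, (S0) the Wilson
start of record has the §2 form under the interval hypothesis and (S1ᵀ) the Theorem of [Balaban1988Convergent] p. 245 holds at the objects of record given
N11's antecedents, then `Dag.B14_main (leavesP w P)` at every run `P` — the (𝐑) slot being the record's pin.
[cite: Balaban1988Convergent, Thm 1 p.262; Theorem p.245; p.244; Balaban1989LargeFieldII, Thm 1 p.355] -/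
theorem b14_main_of_isRecordOfRecord₁₁C (hrec : IsRecordOfRecord₁₁C F N D w)
    (slots : ∀ (θ : Stage11Params F N) (h : θ.Provisos₁₁), θ.Admissible → D = datumOfRecord₁₁ F N θ h →
      w.C = (datumOfRecord₁₁ F N θ h).C → (0 < w.γ ∧ w.γ ≤ θ.γ) → w.L = (θ.L : ℝ) →
      (∀ P, w.up P = upOfRecord₅C F N (θ.toStage5₁₁ F N) P) → ∀ P : B12.RunParams,
        ((leavesP w P).smallCouplings → SLaw₁₁ F N θ P 0) ∧
        ((leavesP w P).b7 → (leavesP w P).b8 → (leavesP w P).b9 → (leavesP w P).b10 → (leavesP w P).b11 →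
          (leavesP w P).smallCouplings → (leavesP w P).smallFieldInductive → (leavesP w P).flowControl →
            ∀ k, k < P.K → SLaw₁₁ F N θ P k → TLaw₁₁ F N θ P k)) :
    ∀ P : B12.RunParams, Dag.B14_main (leavesP w P) := by
  intro P
  obtain ⟨θ, h, hθ, hD, hC, hγ, hL, hup⟩ := hrec
  obtain ⟨h0, hT⟩ := slots θ h hθ hD (by rw [hC, hD]) hγ hL hup P
  exact b14_main_at_record₁₁ F N θ h w P (by rw [hC, hD]) (hup P) h0 hT

/-- **`S_N11 Rec` FOR EVERY RECORD PREDICATE REFINING THE STAGE-11 RECORD** (the route's node stub `YMDAG.UVSplit.S_N11 Rec := AtRecord Rec Dag.B14_main`), from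
the slots (S0), (S1ᵀ) at the objects of record of every presenting Stage-11 parameter of every `Rec`-world — the (𝐑) slot of the n11-a knits
(`BalabanUVNodesN11AtRecord.S_N11_of_towerSlots_along`'s last clause) DISCHARGED by the Stage-11 pin, the §2-form reading by `Iff.rfl`.
[cite: Balaban1988Convergent, Thm 1 p.262; Theorem p.245; p.244; (2.18) p.257; Balaban1989LargeFieldII, Thm 1 p.355] -/
theorem s_N11_of_refines₁₁C (Rec : RecordPred N)
    (href : ∀ (F : T4Family) (D : Datum F N) (w : WorldP), Rec F D w → IsRecordOfRecord₁₁C F N D w)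
    (slots : ∀ (F : T4Family) (D : Datum F N) (w : WorldP), Rec F D w →
      ∀ (θ : Stage11Params F N) (h : θ.Provisos₁₁), θ.Admissible → D = datumOfRecord₁₁ F N θ h →
        w.C = (datumOfRecord₁₁ F N θ h).C → (0 < w.γ ∧ w.γ ≤ θ.γ) → w.L = (θ.L : ℝ) →
        (∀ P, w.up P = upOfRecord₅C F N (θ.toStage5₁₁ F N) P) → ∀ P : B12.RunParams,
          ((leavesP w P).smallCouplings → SLaw₁₁ F N θ P 0) ∧
          ((leavesP w P).b7 → (leavesP w P).b8 → (leavesP w P).b9 → (leavesP w P).b10 → (leavesP w P).b11 →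
            (leavesP w P).smallCouplings → (leavesP w P).smallFieldInductive → (leavesP w P).flowControl →
              ∀ k, k < P.K → SLaw₁₁ F N θ P k → TLaw₁₁ F N θ P k)) :
    S_N11 Rec :=
  fun F D w hR P => b14_main_of_isRecordOfRecord₁₁C (href F D w hR) (slots F D w hR) P

/-- **`S_N11` AT THE STAGE-11 RECORD ITSELF** (`Rec := IsRecordOfRecord₁₁C · N`; the route instantiates `N := 2`): N11 at every run of every Stage-11 record's
world from (S0) + (S1ᵀ) at the objects of record — THE THEOREM OF [Balaban1988Convergent] p. 245 there being the one displayed estimate.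
[cite: Balaban1988Convergent, Thm 1 p.262; Theorem p.245; p.244; Balaban1989LargeFieldII, Thm 1 p.355] -/
theorem s_N11_rec₁₁C
    (slots : ∀ (F : T4Family) (D : Datum F N) (w : WorldP), IsRecordOfRecord₁₁C F N D w →
      ∀ (θ : Stage11Params F N) (h : θ.Provisos₁₁), θ.Admissible → D = datumOfRecord₁₁ F N θ h →
        w.C = (datumOfRecord₁₁ F N θ h).C → (0 < w.γ ∧ w.γ ≤ θ.γ) → w.L = (θ.L : ℝ) →
        (∀ P, w.up P = upOfRecord₅C F N (θ.toStage5₁₁ F N) P) → ∀ P : B12.RunParams,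
          ((leavesP w P).smallCouplings → SLaw₁₁ F N θ P 0) ∧
          ((leavesP w P).b7 → (leavesP w P).b8 → (leavesP w P).b9 → (leavesP w P).b10 → (leavesP w P).b11 →
            (leavesP w P).smallCouplings → (leavesP w P).smallFieldInductive → (leavesP w P).flowControl →
              ∀ k, k < P.K → SLaw₁₁ F N θ P k → TLaw₁₁ F N θ P k)) :
    S_N11 (fun F D w => IsRecordOfRecord₁₁C F N D w) :=
  s_N11_of_refines₁₁C _ (fun _ _ _ hR => hR) slots

end Keyed

end Summit.QuantumFields.YangMills.Theorems.BalabanUVNodesN11AtRecord11C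

end
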